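import Literature.NumberTheory.DiophantineGeometry.MinimalModelUnramifiedProofs
import Literature.NumberTheory.DiophantineGeometry.KodairaSymbolUnramifiedBaseChange
import Literature.NumberTheory.Automorphic.AdeleBaseChange
import HarnessLib

/-!
# Discharge of the named fact `kodairaSymbolAt_baseChange_of_ramificationIdx_eq_one`

Topic `NumberTheory/DiophantineGeometry` (companion proof file of
`Literature.NumberTheory.DiophantineGeometry.KodairaSymbolUnramifiedBaseChange`; theorems only,
no definition, no named fact).  Sixth and last file of the discharge: the named fact
`Literature.NumberTheory.DiophantineGeometry.kodairaSymbolAt_baseChange_of_ramificationIdx_eq_one`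
— **Tate's algorithm (Kodaira symbol AND `ord_v Δ_min`) is insensitive to unramified base change,
in every residue characteristic** (Silverman *AEC* Prop. VII.5.4 (a) with proof; *ATAEC* IV §11
p. 367; Liu 2002 Prop. 10.1.17) — is PROVED as
`kodairaSymbolAt_baseChange_of_ramificationIdx_eq_one_holds`, with the fact's signature consumed
by name.

Proof.  Let `A ⊆ B` be Dedekind domains with fraction fields `K ⊆ L`, `w ∣ v` finite places with
`¬ v·B ≤ w²`.  The local base-change map `ι : K_v →+* L_w`
(`Literature.NumberTheory.Automorphic.adicCompletionOfLiesOver`, any Dedekind `A ⊆ B`) satisfies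
`Valued.v (ι y) = (Valued.v y) ^ e(w|v)` (`valued_adicCompletionOfLiesOver`), and `e(w|v) = 1`
here (`Ideal.ramificationIdx'_spec`), so `ι` preserves valuations, restricts to
`ιₒ : O_v →+* O_w`, and maps a uniformiser of `O_v` to a uniformiser of `O_w` (§1: in `O_v` the
irreducible elements are exactly those of valuation `exp (-1)`).  The square
`K → K_v → L_w = K → L → L_w` identifies `(W ⊗ K_v).map ι` with `(W ⊗ L) ⊗ L_w`, and the
fraction-field theorems of `MinimalModelUnramifiedProofs`
(`WeierstrassCurve.kodairaSymbol_eq_of_eq_map`, `WeierstrassCurve.addVal_Δ_minimal_eq_of_eq_map`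
— Tate's algorithm coupled along `ιₒ`, and minimality persistence via Step 11) give both
conjuncts.  The instances `Algebra A L`, `IsScalarTower A K L`, `IsScalarTower A B L`,
`Module.IsTorsionFree A B`, `w.LiesOver v` that `adicCompletionOfLiesOver` wants are built inside
the proof from the fact's two `Prop` hypotheses (the square commutes; `w ∩ A = v`).

## Prior formalisation in the tree (x11b3-p4 lineage, `Summits/BirchSwinnertonDyer/Rank1Residual/X11b/Three/`)

`KodairaTransportMain.kodairaSymbolOfMinimal_map_of_unif` proves the same DVR-level coupling as
`WeierstrassCurve.kodairaSymbolOfMinimal_map_of_map_uniformizer` (with `[IsLocalHom ψ]` assumed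
rather than derived from `hw`); `KodairaTransportFraction.kodairaSymbol_map_of_unif` is the
fraction-field statement WITH a minimality hypothesis `hmin`; `UnramifiedMinimalDescent
.isMinimal_baseChange_of_frobenius` proves minimality persistence on a finite Galois unramified
layer of local fields by Galois descent of the non-minimality witness (no Tate's algorithm).  The
present Literature-side files exist because a Literature `_holds` cannot import `Summits/…`, and add:
minimality persistence for EVERY ring homomorphism of DVRs with `f π₁ = w π₂` and perfect residue
fields (via Step 11 read forwards), the fraction-field statement without `hmin`, and the discharge
of the registry fact itself at arbitrary Dedekind `A ⊆ B`.

## References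

* J. H. Silverman, *The Arithmetic of Elliptic Curves*, GTM 106, 2nd ed. 2009, Prop. VII.5.4 (a)
  and its proof ("for arbitrary characteristic this follows from Tate's algorithm").
* J. H. Silverman, *Advanced Topics in the Arithmetic of Elliptic Curves*, GTM 151, 1994, IV.9.4
  and IV §11, proof of 11.1 (PDF p. 367).
* Q. Liu, *Algebraic Geometry and Arithmetic Curves*, OUP 2002, Prop. 10.1.17 with Thm. 9.4.35,
  Cor. 9.4.38, §10.2.1.
* J. Tate, *Algorithm for determining the type of a singular fiber in an elliptic pencil*, in
  Modular Functions of One Variable IV, LNM 476, 1975, 33–52 (`TateLNM476`; cited through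
  Silverman ATAEC IV.9.4, "(Tate [2])" — the primary is not held on this hub).
-/

noncomputable section

open IsDedekindDomain IsLocalRing

namespace Literature.NumberTheory.DiophantineGeometry

namespace UnramifiedBaseChange

/-! ### §1 Uniformisers of `O_v` are the elements of valuation `exp (-1)` -/

section Uniformizers

variable {A : Type*} [CommRing A] [IsDedekindDomain A] {K : Type*} [Field K] [Algebra A K]
  [IsFractionRing A K] (v : HeightOneSpectrum A)

/-- `exp (-1)` is a value of `Valued.v` on `O_v` (Mathlib `valuation_exists_uniformizer`).  (Same
statement as the Summits-side `TypeIVTwist.exists_valued_eq_exp_neg_one`, which a `Literature`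
file does not import.) [folklore] -/
private theorem exists_valued_eq_exp_neg_one :
    ∃ π : v.adicCompletionIntegers K, Valued.v (π : v.adicCompletion K) = WithZero.exp (-1 : ℤ) := by
  obtain ⟨x, hx⟩ := v.valuation_exists_uniformizer K
  have hx' : Valued.v ((x : K) : v.adicCompletion K) = WithZero.exp (-1 : ℤ) := by
    rw [HeightOneSpectrum.valuedAdicCompletion_eq_valuation', hx]
  refine ⟨⟨(x : v.adicCompletion K), ?_⟩, hx'⟩
  rw [HeightOneSpectrum.mem_adicCompletionIntegers, hx', ← WithZero.exp_zero, WithZero.exp_le_exp]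
  norm_num

/-- `exp (-1) ≠ 1` in `ℤᵐ⁰`. [folklore] -/
private theorem exp_neg_one_ne_one :
    WithZero.exp (-1 : ℤ) ≠ (1 : WithZero (Multiplicative ℤ)) :=
  ((WithZero.exp_lt_exp.mpr (by norm_num)).trans_eq WithZero.exp_zero).ne

/-- A non-unit of `O_v` has valuation `≤ exp (-1)` (discreteness of `Valued.v`). [folklore] -/
private theorem valued_le_exp_neg_one_of_not_isUnit {x : v.adicCompletionIntegers K} (hx : ¬ IsUnit x) :
    Valued.v (x : v.adicCompletion K) ≤ WithZero.exp (-1 : ℤ) := by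
  rw [HeightOneSpectrum.adicCompletionIntegers.isUnit_iff_valued_eq_one] at hx
  have hle : Valued.v (x : v.adicCompletion K) ≤ 1 := x.2
  rcases eq_or_ne (Valued.v (x : v.adicCompletion K)) 0 with h0 | h0
  · rw [h0]; exact zero_le
  · rw [← WithZero.exp_log h0] at hx hle ⊢
    rw [← WithZero.exp_zero, WithZero.exp_le_exp] at hle
    have hm0 : WithZero.log (Valued.v (x : v.adicCompletion K)) ≠ 0 := fun h ↦
      hx (by rw [h, WithZero.exp_zero])
    rw [WithZero.exp_le_exp]
    omega

/-- **An element of `O_v` is irreducible iff its valuation is `exp (-1)`** (the uniformisers of the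
complete discrete valuation ring `O_v`; Serre, *Local Fields*, II §1). [folklore] -/
private theorem irreducible_iff_valued_eq_exp_neg_one (x : v.adicCompletionIntegers K) :
    Irreducible x ↔ Valued.v (x : v.adicCompletion K) = WithZero.exp (-1 : ℤ) := by
  constructor
  · intro hx
    obtain ⟨π, hπ⟩ := exists_valued_eq_exp_neg_one (K := K) v
    have hπu : ¬ IsUnit π := by
      rw [HeightOneSpectrum.adicCompletionIntegers.isUnit_iff_valued_eq_one, hπ]
      exact exp_neg_one_ne_one
    have hπmem : π ∈ maximalIdeal (v.adicCompletionIntegers K) := hπu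
    rw [(IsDiscreteValuationRing.irreducible_iff_uniformizer x).mp hx, Ideal.mem_span_singleton]
      at hπmem
    obtain ⟨t, ht⟩ := hπmem
    have hxle := valued_le_exp_neg_one_of_not_isUnit (K := K) v hx.not_isUnit
    have htle : Valued.v (t : v.adicCompletion K) ≤ 1 := t.2
    refine le_antisymm hxle ?_
    have hmul : Valued.v (x : v.adicCompletion K) * Valued.v (t : v.adicCompletion K) =
        WithZero.exp (-1 : ℤ) := by
      rw [← Valuation.map_mul, ← Subring.coe_mul, ← ht, hπ]
    calc WithZero.exp (-1 : ℤ)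
        = Valued.v (x : v.adicCompletion K) * Valued.v (t : v.adicCompletion K) := hmul.symm
      _ ≤ Valued.v (x : v.adicCompletion K) * 1 := by gcongr
      _ = Valued.v (x : v.adicCompletion K) := mul_one _
  · intro hx
    have hxu : ¬ IsUnit x := by
      rw [HeightOneSpectrum.adicCompletionIntegers.isUnit_iff_valued_eq_one, hx]
      exact exp_neg_one_ne_one
    refine ⟨hxu, fun a b hab ↦ ?_⟩
    by_contra h
    push Not at h
    obtain ⟨ha, hb⟩ := h
    have hale := valued_le_exp_neg_one_of_not_isUnit (K := K) v ha
    have hble := valued_le_exp_neg_one_of_not_isUnit (K := K) v hb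
    have hmul : Valued.v (x : v.adicCompletion K) =
        Valued.v (a : v.adicCompletion K) * Valued.v (b : v.adicCompletion K) := by
      rw [← Valuation.map_mul, ← Subring.coe_mul, ← hab]
    have hle : Valued.v (x : v.adicCompletion K) ≤
        WithZero.exp (-1 : ℤ) * WithZero.exp (-1 : ℤ) := by
      rw [hmul]; exact mul_le_mul' hale hble
    rw [hx, ← WithZero.exp_add, WithZero.exp_le_exp] at hle
    norm_num at hle

end Uniformizers

/-! ### §2 The local map of an unramified place and the discharge -/

section Holds

variable {A : Type*} [CommRing A] [IsDedekindDomain A] {K : Type*} [Field K] [Algebra A K]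
  [IsFractionRing A K]
  {B : Type*} [CommRing B] [IsDedekindDomain B] (L : Type*) [Field L] [Algebra B L]
  [IsFractionRing B L]
  [Algebra A B] [Algebra K L]
  (v : HeightOneSpectrum A) (w : HeightOneSpectrum B) (W : WeierstrassCurve K)

omit [IsDedekindDomain A] [IsDedekindDomain B] in
/-- `e(w | v) = 1` in Mathlib's `Ideal.ramificationIdx'` currency from the fact's hypotheses
`w ∩ A = v` and `¬ v·B ≤ w²`. [folklore] -/
private theorem ramificationIdx'_eq_one_of_not_le_sq (hvw : w.asIdeal.under A = v.asIdeal)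
    (he : ¬ v.asIdeal.map (algebraMap A B) ≤ w.asIdeal ^ 2) :
    v.asIdeal.ramificationIdx' w.asIdeal = 1 := by
  refine Ideal.ramificationIdx'_spec ?_ he
  rw [pow_one, Ideal.map_le_iff_le_comap, ← Ideal.under_def, hvw]

/-- **Discharge of the named fact A233**
`Literature.NumberTheory.DiophantineGeometry.kodairaSymbolAt_baseChange_of_ramificationIdx_eq_one`:
for Dedekind `A ⊆ B` with fraction fields `K ⊆ L` (`B` finite over `A`, the square commuting),
finite places `w ∣ v` with `e(w | v) = 1` and perfect residue fields of `O_v`, `O_w`, and an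
elliptic `W / K`, Tate's algorithm gives the same Kodaira symbol and the same `ord Δ_min` for
`W_L` at `w` as for `W` at `v`.  Silverman, *AEC* Prop. VII.5.4 (a) with proof ("for arbitrary
characteristic this follows from Tate's algorithm"); *ATAEC* IV §11, proof of 11.1 (PDF p. 367:
"if `M/K` is unramified … none of the quantities … will change"); Liu 2002 Prop. 10.1.17.  Our
proof: the coupling of the literal algorithm along the unramified local homomorphism
`O_v → O_w` (`WeierstrassCurve.kodairaSymbolOfMinimal_map_of_map_uniformizer`) and minimality
persistence via Step 11 (`WeierstrassCurve.isMinimal_map_of_map_uniformizer`).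
[cite: SilvermanAEC2009, Prop. VII.5.4 (a) with proof (p. 197)] [cite: SilvermanATAEC1994, IV §11, proof of 11.1 (PDF p. 367), with IV.9.4] [cite: Liu2002, Prop. 10.1.17] -/
theorem kodairaSymbolAt_baseChange_of_ramificationIdx_eq_one_holds :
    kodairaSymbolAt_baseChange_of_ramificationIdx_eq_one L v w W := by
  intro _ _ _ _ hsq hvw he
  classical
  -- the instances `adicCompletionOfLiesOver` wants, from the two `Prop` hypotheses
  letI instAL : Algebra A L := ((algebraMap K L).comp (algebraMap A K)).toAlgebra
  haveI : IsScalarTower A K L := IsScalarTower.of_algebraMap_eq (fun _ ↦ rfl)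
  haveI : IsScalarTower A B L :=
    IsScalarTower.of_algebraMap_eq (fun a ↦ by
      change ((algebraMap K L).comp (algebraMap A K)) a = _
      rw [hsq]; rfl)
  have hinj : Function.Injective (algebraMap A B) := by
    have h2 : Function.Injective ((algebraMap B L).comp (algebraMap A B)) := by
      rw [← hsq]
      exact (algebraMap K L).injective.comp (IsFractionRing.injective A K)
    exact Function.Injective.of_comp h2
  haveI : Module.IsTorsionFree A B := Module.isTorsionFree_iff_algebraMap_injective.mpr hinj
  haveI : w.asIdeal.LiesOver v.asIdeal := ⟨hvw.symm⟩
  -- the local map and `e = 1`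
  set ι := Literature.NumberTheory.Automorphic.adicCompletionOfLiesOver K L v w with hι
  have he1 := ramificationIdx'_eq_one_of_not_le_sq v w hvw he
  have hval : ∀ y : v.adicCompletion K, Valued.v (ι y) = Valued.v y := fun y ↦ by
    rw [hι, Literature.NumberTheory.Automorphic.valued_adicCompletionOfLiesOver, he1, pow_one]
  -- restriction to the valuation rings
  let ιₒ : v.adicCompletionIntegers K →+* w.adicCompletionIntegers L :=
    (ι.comp (v.adicCompletionIntegers K).subtype).codRestrict (w.adicCompletionIntegers L)
      (fun x ↦ Literature.NumberTheory.Automorphic.adicCompletionOfLiesOver_mem_adicCompletionIntegers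
        K L v w x.2)
  have hc : ∀ r : v.adicCompletionIntegers K,
      ι (algebraMap (v.adicCompletionIntegers K) (v.adicCompletion K) r) =
        algebraMap (w.adicCompletionIntegers L) (w.adicCompletion L) (ιₒ r) := fun _ ↦ rfl
  -- `ιₒ` maps a uniformiser to a uniformiser
  obtain ⟨u, hu⟩ : ∃ u : (w.adicCompletionIntegers L)ˣ,
      ιₒ (TateAlgorithm.uniformizer (v.adicCompletionIntegers K)) =
        ↑u * TateAlgorithm.uniformizer (w.adicCompletionIntegers L) := by
    have h1 : Irreducible (ιₒ (TateAlgorithm.uniformizer (v.adicCompletionIntegers K))) := by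
      rw [irreducible_iff_valued_eq_exp_neg_one]
      change Valued.v (ι _) = _
      rw [hval]
      exact (irreducible_iff_valued_eq_exp_neg_one v _).mp TateAlgorithm.irreducible_uniformizer
    obtain ⟨u, hu⟩ := IsDiscreteValuationRing.associated_of_irreducible _
      TateAlgorithm.irreducible_uniformizer h1
    exact ⟨u, by rw [← hu, mul_comm]⟩
  -- the square `K → K_v → L_w = K → L → L_w` on `W`
  have hΔ : (W.baseChange (v.adicCompletion K)).Δ ≠ 0 := by
    rw [WeierstrassCurve.baseChange, WeierstrassCurve.map_Δ]
    exact (map_ne_zero_iff _ (algebraMap K (v.adicCompletion K)).injective).mpr W.isUnit_Δ.ne_zero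
  have hY : (W.baseChange L).baseChange (w.adicCompletion L) =
      (W.baseChange (v.adicCompletion K)).map ι := by
    rw [WeierstrassCurve.baseChange, WeierstrassCurve.baseChange, WeierstrassCurve.baseChange,
      WeierstrassCurve.map_map, WeierstrassCurve.map_map]
    congr 1
    ext x
    rw [RingHom.comp_apply, RingHom.comp_apply, HeightOneSpectrum.algebraMap_adicCompletion,
      HeightOneSpectrum.algebraMap_adicCompletion, Function.comp_apply, Function.comp_apply,
      Algebra.algebraMap_self_apply, Algebra.algebraMap_self_apply, hι,
      Literature.NumberTheory.Automorphic.adicCompletionOfLiesOver_coe]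
  refine ⟨?_, ?_⟩
  · -- Kodaira symbol
    rw [WeierstrassCurve.kodairaSymbolAt, WeierstrassCurve.kodairaSymbolAt]
    exact WeierstrassCurve.kodairaSymbol_eq_of_eq_map ιₒ ι hc hu _ hΔ hY
  · -- `ord Δ_min`
    exact congrArg ENat.toNat (WeierstrassCurve.addVal_Δ_minimal_eq_of_eq_map ιₒ ι hc hu _ hΔ hY)

end Holds

end UnramifiedBaseChange

end Literature.NumberTheory.DiophantineGeometry

/-! ### §3 The discharge under the fact's own name

Accounting alias (lit GEN 65 flag `A233-holds-subnamespace`, CITED-FACTS S-g65-3): the discharge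
theorem of §2 lives in the sub-namespace `UnramifiedBaseChange`; this section re-exports it beside
the `def`, as `Literature.NumberTheory.DiophantineGeometry.kodairaSymbolAt_baseChange_of_ramificationIdx_eq_one_holds`,
over the def's own variable line, so that the `<fact>_holds` naming convention (D-0026) is met
literally. No new mathematics. -/

namespace Literature.NumberTheory.DiophantineGeometry

section HoldsAlias

variable {A : Type*} [CommRing A] [IsDedekindDomain A] {K : Type*} [Field K] [Algebra A K]
  [IsFractionRing A K]
  {B : Type*} [CommRing B] [IsDedekindDomain B] (L : Type*) [Field L] [Algebra B L]
  [IsFractionRing B L]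
  [Algebra A B] [Algebra K L]
  (v : HeightOneSpectrum A) (w : HeightOneSpectrum B) (W : WeierstrassCurve K)

/-- **The named fact A233 under its own name**:
`kodairaSymbolAt_baseChange_of_ramificationIdx_eq_one L v w W` holds — Tate's algorithm gives the
same Kodaira symbol and the same `ord Δ_min` for `W_L` at `w` as for `W` at `v` whenever
`e(w | v) = 1` (Dedekind `A ⊆ B`, fraction fields `K ⊆ L`, perfect residue fields). Alias of
`UnramifiedBaseChange.kodairaSymbolAt_baseChange_of_ramificationIdx_eq_one_holds` (§2 of this file),
re-exported in the def's namespace for the `<fact>_holds` convention; Silverman, *AEC* Prop. VII.5.4 (a)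
with proof; *ATAEC* IV §11, proof of 11.1; Liu 2002 Prop. 10.1.17.
[cite: SilvermanAEC2009, Prop. VII.5.4 (a) with proof (p. 197)] [cite: SilvermanATAEC1994, IV §11, proof of 11.1 (PDF p. 367), with IV.9.4] [cite: Liu2002, Prop. 10.1.17] -/
theorem kodairaSymbolAt_baseChange_of_ramificationIdx_eq_one_holds :
    kodairaSymbolAt_baseChange_of_ramificationIdx_eq_one L v w W :=
  UnramifiedBaseChange.kodairaSymbolAt_baseChange_of_ramificationIdx_eq_one_holds L v w W

end HoldsAlias

end Literature.NumberTheory.DiophantineGeometry
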